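/-
Copyright: derived here (Resolution Observatory cell `pub-rosobs`, carver gen 57). AI-written Lean; AI review is weaker than expert
review.  The end-to-end assembly of engine 1's LEMMA LL, Statement A (THEOREM-LT-eng1-g38 §2, the identity `(ID_h)`) for the cell's
POLYNOMIAL weighted-centre model `W(f)`, from the two ingredient modules `WeightedCentreDerivationLayers` (the graded split `D = D_C + D_L`
and the `C`-layer identity) and `WeightedCentreHeavyFactorisation` (class-freeness by weight; `comp_h g = X^h · G_h`).
Instrument — NOT a resolution theorem and NOT a statement about the invariant of [AbramovichTemkinWlodarczyk2024].
-/
import Literature.AlgebraicGeometry.Resolution.WeightedCentreDerivationLayers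
import Literature.AlgebraicGeometry.Resolution.WeightedCentreHeavyFactorisation
import HarnessLib

/-!
# LEMMA LL, Statement A, assembled: `D g = 0 ⇒ D(G_h) = 0 ⇒ ∂_T P_h = − Σ_β ε_C^β · D(r_{h,β})`

Uniform value line: INSTRUMENT — kernel-checked bookkeeping for engine 1's LEMMA LL (THEOREM-LT-eng1-g38 §2) in the cell's polynomial
weighted-centre model `W(f)`; NOT a resolution theorem, NOT a statement about the Abramovich–Temkin–Włodarczyk invariant, NOT summit
progress; AI-written Lean, AI review is weaker than expert review.

Setting (THEOREM-LT §0–§2): slots `σ`, weights `w : σ → M` (`M` an ordered abelian group, e.g. `ℚ`), `w ≥ 0`; a class `C` and the heavy slots `H`,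
all of weight `≥ w₀`; a derivation `D` of `R[ε]` with `D(ε_y) = 0` for `y ∈ H` and every other `D(ε_i)` either `0` or `w`-homogeneous of a weight
`κ_i < w₀` (this is "graded of degree `−ρ < 0`": `D(ε_f)` has weight `w₀ − ρ` on `C`, `D(ε_i)` has weight `w_i − ρ < w₀` on the light slots).
Consequences typed here:
* every `D(ε_i)` is `H`-free and `C`-free, i.e. of degree `0` for the heavy-exponent weight `heavyExp H` and for the `C`-degree `cDeg C`
  (**`isWeightedHomogeneous_heavyExp_zero`**, **`isWeightedHomogeneous_cDeg_zero`**);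
* `D g = 0 ⇒ D(G_h) = 0` for every heavy part `h`, where `comp_h g = ε^h · G_h` (**`apply_heavyQuot_eq_zero`**; `R` a domain);
* **`lemma_LL_A`** (`(ID_h)` for every layer): `D_C (comp^C_{k+1} G_h) = − D_L (comp^C_k G_h)` for every `k`, with `D_C = Σ_{f∈C} D(ε_f) ∂_f = ∂_T`
  and `D_L = Σ_{i∉C} D(ε_i) ∂_i`; at `k + 1 = d_h` (the `C`-degree of `G_h`) the two sides are `∂_T P_h` and `− D_L ℛ_h`;
* the left-hand operator is `∂_T`: `D_C (ε_f) = D(ε_f) = T_f` on `C`, `0` off `C` — this is the landed `DerivationLayers.C_part_X`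
  (not restated here);
* the right-hand side on a layer written as `Σ_β ε_C^β · r_β` with light `r_β`: `D_L (ε_C^β · r) = ε_C^β · D(r)` (**`D_L_monomial_mul`**), so
  `− D_L ℛ_h = − Σ_β ε_C^β · D(r_{h,β})` literally.
What is NOT here: Statement B (the left inverse of `Κ`; module `WeightedCentreLTKit`), LEMMA K, the induction of THEOREM LT.

References: [AbramovichTemkinWlodarczyk2024] §5 (weighted centres; context only); [Lang2002] Ch. XIX §3 (derivations of polynomial rings).
Statements ours (engine 1 gen 38), proofs elementary.
-/

namespace Literature.AlgebraicGeometry.Resolution.WeightedBlowup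

namespace LemmaLL

open MvPolynomial HeavyDecomposition DerivationLayers

variable {σ R : Type*} [CommRing R]

/-! ## Freeness for the two auxiliary gradings -/

section Free

variable (H : Set σ) [DecidablePred (· ∈ H)]

/-- A polynomial without heavy variables has heavy-exponent degree `0`. [cite: AbramovichTemkinWlodarczyk2024, §5] -/
theorem isWeightedHomogeneous_heavyExp_zero_of_notMem_vars {Q : MvPolynomial σ R} (hQ : ∀ y ∈ H, y ∉ Q.vars) :
    IsWeightedHomogeneous (heavyExp H) Q 0 := by
  intro d hd
  rw [weight_heavyExp]
  ext y
  rw [Finsupp.filter_apply, Finsupp.coe_zero, Pi.zero_apply]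
  split_ifs with hy
  · by_contra hdy
    exact hQ y hy ((mem_vars_iff_mem_support y).mpr ⟨d, mem_support_iff.mpr hd, Finsupp.mem_support_iff.mpr hdy⟩)
  · rfl

/-- The `C`-degree: `1` on `C`, `0` off `C`. [cite: AbramovichTemkinWlodarczyk2024, §5] -/
def cDeg (C : Set σ) [DecidablePred (· ∈ C)] : σ → ℕ := fun i => if i ∈ C then 1 else 0

/-- `C`-degree `1` on `C` (plumbing). [cite: AbramovichTemkinWlodarczyk2024, §5] -/
theorem cDeg_of_mem {C : Set σ} [DecidablePred (· ∈ C)] {i : σ} (hi : i ∈ C) : cDeg C i = 1 := if_pos hi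

/-- `C`-degree `0` off `C` (plumbing). [cite: AbramovichTemkinWlodarczyk2024, §5] -/
theorem cDeg_of_notMem {C : Set σ} [DecidablePred (· ∈ C)] {i : σ} (hi : i ∉ C) : cDeg C i = 0 := if_neg hi

variable {M : Type*} [AddCommGroup M] [PartialOrder M] [IsOrderedAddMonoid M] {w : σ → M} {w₀ : M}

/-- `H`-freeness by weight: `D(ε_i) = 0` or of weight `κ < w₀ ≤ w(H)` ⇒ heavy-exponent degree `0`. [cite: AbramovichTemkinWlodarczyk2024, §5] -/
theorem isWeightedHomogeneous_heavyExp_zero (hw : ∀ j, 0 ≤ w j) (hHw : ∀ y ∈ H, w₀ ≤ w y) {Q : MvPolynomial σ R}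
    (hQ : Q = 0 ∨ ∃ κ, IsWeightedHomogeneous w Q κ ∧ κ < w₀) : IsWeightedHomogeneous (heavyExp H) Q 0 := by
  rcases hQ with rfl | ⟨κ, hQκ, hκ⟩
  · exact isWeightedHomogeneous_zero R _ _
  · exact isWeightedHomogeneous_heavyExp_zero_of_notMem_vars H fun y hy => notMem_vars_of_weight_lt hw hHw hQκ hκ hy

/-- `C`-freeness by weight: `D(ε_i) = 0` or of weight `κ < w₀ ≤ w(C)` ⇒ `C`-degree `0`. [cite: AbramovichTemkinWlodarczyk2024, §5] -/
theorem isWeightedHomogeneous_cDeg_zero {C : Set σ} [DecidablePred (· ∈ C)] (hw : ∀ j, 0 ≤ w j) (hCw : ∀ f ∈ C, w₀ ≤ w f)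
    {Q : MvPolynomial σ R} (hQ : Q = 0 ∨ ∃ κ, IsWeightedHomogeneous w Q κ ∧ κ < w₀) : IsWeightedHomogeneous (cDeg C) Q 0 := by
  rcases hQ with rfl | ⟨κ, hQκ, hκ⟩
  · exact isWeightedHomogeneous_zero R _ _
  · exact isWeightedHomogeneous_zero_of_weight_lt hw hCw (fun i hi => cDeg_of_notMem hi) hQκ hκ

end Free

/-! ## `D g = 0 ⇒ D(G_h) = 0` -/

section HeavyStep

variable {H : Set σ} [DecidablePred (· ∈ H)]

/-- Off the heavy slots the heavy-exponent weight vanishes (plumbing). [cite: AbramovichTemkinWlodarczyk2024, §5] -/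
theorem heavyExp_apply_of_notMem {i : σ} (hi : i ∉ H) : heavyExp H i = 0 := by
  simp only [heavyExp, if_neg hi]

/-- `D` kills the heavy slots and no `D(ε_i)` involves a heavy variable ⇒ `D (comp_h g) = 0` whenever `D g = 0`.
[cite: AbramovichTemkinWlodarczyk2024, §5] -/
theorem apply_component_eq_zero (D : Derivation R (MvPolynomial σ R) (MvPolynomial σ R)) (hDH : ∀ y ∈ H, D (X y) = 0)
    (hD0 : ∀ i, IsWeightedHomogeneous (heavyExp H) (D (X i)) 0) {g : MvPolynomial σ R} (hg : D g = 0) (h : σ →₀ ℕ) :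
    D (weightedHomogeneousComponent (heavyExp H) h g) = 0 := by
  have hH' : ∀ i, heavyExp H i ≠ 0 → D (X i) = 0 := fun i hi => hDH i (by
    by_contra hiH
    exact hi (heavyExp_apply_of_notMem hiH))
  exact apply_component_eq_zero_of_degree_zero (v := heavyExp H) D hD0 hH' hg h

/-- **`D g = 0 ⇒ D(G_h) = 0`** (`R` a domain): with `comp_h g = ε^h · G_h` and `D(ε^h) = 0`. [cite: AbramovichTemkinWlodarczyk2024, §5] -/
theorem apply_heavyQuot_eq_zero [IsDomain R] (D : Derivation R (MvPolynomial σ R) (MvPolynomial σ R)) (hDH : ∀ y ∈ H, D (X y) = 0)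
    (hD0 : ∀ i, IsWeightedHomogeneous (heavyExp H) (D (X i)) 0) {g : MvPolynomial σ R} (hg : D g = 0) (h : σ →₀ ℕ) :
    D (heavyQuot h (weightedHomogeneousComponent (heavyExp H) h g)) = 0 := by
  by_cases hQ0 : weightedHomogeneousComponent (heavyExp H) h g = 0
  · have : heavyQuot h (weightedHomogeneousComponent (heavyExp H) h g) = 0 := by
      rw [heavyQuot, hQ0, support_zero, Finset.sum_empty]
    rw [this, map_zero]
  · have hcomp := apply_component_eq_zero D hDH hD0 hg h
    rw [weightedHomogeneousComponent_eq_monomial_mul (H := H) g h] at hcomp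
    refine apply_eq_zero_of_monomial_mul D (fun y hy => hDH y ?_) one_ne_zero hcomp
    exact support_subset_of_isWeightedHomogeneous (weightedHomogeneousComponent_isWeightedHomogeneous h g) hQ0 y hy

end HeavyStep

/-! ## `(ID_h)` -/

section Identity

variable (C : Set σ) [DecidablePred (· ∈ C)] {H : Set σ} [DecidablePred (· ∈ H)]
variable {M : Type*} [AddCommGroup M] [PartialOrder M] [IsOrderedAddMonoid M] {w : σ → M} {w₀ : M}

/-- **LEMMA LL, Statement A** (`(ID_h)`, every layer).  Weights `w ≥ 0`; `C` and `H` of weight `≥ w₀`; `D` kills `H` and every `D(ε_i)` is `0` or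
`w`-homogeneous of a weight `< w₀`; `D g = 0`; `R` a domain.  Then for every heavy part `h` and every `k`, with `G_h` the heavy quotient of `comp_h g`:
`D_C (comp^C_{k+1} G_h) = − D_L (comp^C_k G_h)`. [cite: AbramovichTemkinWlodarczyk2024, §5] -/
theorem lemma_LL_A [IsDomain R] (hw : ∀ j, 0 ≤ w j) (hCw : ∀ f ∈ C, w₀ ≤ w f) (hHw : ∀ y ∈ H, w₀ ≤ w y)
    (D : Derivation R (MvPolynomial σ R) (MvPolynomial σ R)) (hDH : ∀ y ∈ H, D (X y) = 0)
    (hDlt : ∀ i, D (X i) = 0 ∨ ∃ κ, IsWeightedHomogeneous w (D (X i)) κ ∧ κ < w₀)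
    {g : MvPolynomial σ R} (hg : D g = 0) (h : σ →₀ ℕ) (k : ℕ) :
    mkDerivation R (fun i => if i ∈ C then D (X i) else 0)
        (weightedHomogeneousComponent (cDeg C) (k + 1) (heavyQuot h (weightedHomogeneousComponent (heavyExp H) h g))) =
      - mkDerivation R (fun i => if i ∈ C then 0 else D (X i))
        (weightedHomogeneousComponent (cDeg C) k (heavyQuot h (weightedHomogeneousComponent (heavyExp H) h g))) :=
  layer_identity_of_apply_eq_zero C (fun _ hi => cDeg_of_mem hi) (fun _ hi => cDeg_of_notMem hi) D
    (fun i => isWeightedHomogeneous_cDeg_zero hw hCw (hDlt i))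
    (apply_heavyQuot_eq_zero D hDH (fun i => isWeightedHomogeneous_heavyExp_zero H hw hHw (hDlt i)) hg h) k

/-- From the notes' phrasing: `D` GRADED OF DEGREE `−ρ < 0` (`DerivationLayers.IsGradedCoeff w ρ (D ∘ ε)`: each non-zero `D(ε_i)` is
`w`-homogeneous of weight `w_i − ρ`) and every non-heavy slot of weight `≤ w₀` give the hypothesis `hDlt` of `lemma_LL_A`.
[cite: AbramovichTemkinWlodarczyk2024, §5] -/
theorem apply_X_zero_or_weight_lt {ρ : M} (hρ : 0 < ρ) (hL : ∀ i ∉ H, w i ≤ w₀)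
    (D : Derivation R (MvPolynomial σ R) (MvPolynomial σ R)) (hDH : ∀ y ∈ H, D (X y) = 0)
    (hgr : IsGradedCoeff w ρ (fun i => D (X i))) (i : σ) :
    D (X i) = 0 ∨ ∃ κ, IsWeightedHomogeneous w (D (X i)) κ ∧ κ < w₀ := by
  by_cases hiH : i ∈ H
  · exact Or.inl (hDH i hiH)
  · by_cases h0 : D (X i) = 0
    · exact Or.inl h0
    · obtain ⟨δ, hδ, hδρ⟩ := hgr i h0
      refine Or.inr ⟨δ, hδ, lt_of_lt_of_le ?_ (hL i hiH)⟩
      rw [← hδρ]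
      exact lt_add_of_pos_right δ hρ

/-- **LEMMA LL, Statement A**, graded phrasing: `D` graded of degree `−ρ < 0`, killing the heavy slots `H`, all other slots of weight `≤ w₀ ≤` the
weights of `C` and `H`, `D g = 0`, `R` a domain ⇒ `(ID_h)` on every layer. [cite: AbramovichTemkinWlodarczyk2024, §5] -/
theorem lemma_LL_A_graded [IsDomain R] (hw : ∀ j, 0 ≤ w j) (hCw : ∀ f ∈ C, w₀ ≤ w f) (hHw : ∀ y ∈ H, w₀ ≤ w y) (hL : ∀ i ∉ H, w i ≤ w₀)
    {ρ : M} (hρ : 0 < ρ) (D : Derivation R (MvPolynomial σ R) (MvPolynomial σ R)) (hDH : ∀ y ∈ H, D (X y) = 0)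
    (hgr : IsGradedCoeff w ρ (fun i => D (X i))) {g : MvPolynomial σ R} (hg : D g = 0) (h : σ →₀ ℕ) (k : ℕ) :
    mkDerivation R (fun i => if i ∈ C then D (X i) else 0)
        (weightedHomogeneousComponent (cDeg C) (k + 1) (heavyQuot h (weightedHomogeneousComponent (heavyExp H) h g))) =
      - mkDerivation R (fun i => if i ∈ C then 0 else D (X i))
        (weightedHomogeneousComponent (cDeg C) k (heavyQuot h (weightedHomogeneousComponent (heavyExp H) h g))) :=
  lemma_LL_A C hw hCw hHw D hDH (apply_X_zero_or_weight_lt hρ hL D hDH hgr) hg h k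

/-- The right-hand operator on a term `ε_C^β · r` with `β` inside `C` and `r` free of `C`: `D_L (ε_C^β · r) = ε_C^β · D(r)`.
[cite: Lang2002, Ch. XIX §3] -/
theorem D_L_monomial_mul (D : Derivation R (MvPolynomial σ R) (MvPolynomial σ R)) {β : σ →₀ ℕ} (hβ : ∀ f ∈ β.support, f ∈ C)
    (c : R) {r : MvPolynomial σ R} (hr : ∀ i ∈ r.vars, i ∉ C) :
    mkDerivation R (fun j => if j ∈ C then 0 else D (X j)) (monomial β c * r) = monomial β c * D r := by
  rw [apply_monomial_mul _ (fun f hf => by rw [mkDerivation_X, if_pos (hβ f hf)]) c r]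
  congr 1
  exact derivation_eq_of_forall_mem_vars fun i hi => by rw [mkDerivation_X, if_neg (hr i hi)]

end Identity

end LemmaLL

end Literature.AlgebraicGeometry.Resolution.WeightedBlowup
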